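import Literature.NumberTheory.PAdicHodge.BmaxPlusTransportedReciprocityInputs
import Literature.NumberTheory.EllipticCurves.TateModuleFinrankProofs
import Literature.NumberTheory.EllipticCurves.TateModuleFreeProofs
import HarnessLib

/-!
# Kato's explicit reciprocity law at a completion for the RAMIFIED good models `W_D ≡ E₀ (mod ϖ)` at deep formal points —
# canonical matching, transported integrating pair, (K₂), `Fil¹`, non-degeneracy and the branch ALL discharged

Topic `Literature/NumberTheory/PAdicHodge`; THEOREMS ONLY (no definition, no named fact, no instance, no `sorry`). Sequel of
`BmaxPlusTransportedReciprocity` (★★★ `exists_const_tatePairingPoint_eq_neg_trace_of_KTwo_transported_of_matching`: the socket capstone with the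
recombined transported Hodge pair along an ABSTRACT matching, modulo (K₂) in the transported `c_L`-free crystalline form) and of
`BmaxPlusTransportedReciprocityInputs` (its hypotheses discharged: `Pω″ ⊆ Fil¹`, the branch, the per-point Kummer data with (K₂)) — the ramified
twin of `BmaxPlusPhiRoadReciprocityFormalPoint`. Brick T5 of memos
`Summits/BirchSwinnertonDyer/BirchSwinnertonDyer/Cruxes/StarredOptimalManinUnitFiveSeven/Lines/kato-lever-K2-transported-period-hom.md` §2/§6 and
`…/kato-lever-K2-ramified-cm-transport.md` §10.2 (line `kato_lever`, crux K★ `stmt-BirchSwinnertonDyer-22226`).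

Setting: `F = K_v`; `D` an Eisenstein datum; `E = curveFO F (W_D ⊗_ψ 𝒪_F)` the good SUPERSINGULAR `𝒪_D`-model (`Δ ∈ 𝒪_F^×`, Hasse coefficient `0`)
congruent mod `ϖ` to `E₀/ℤ` (good supersingular at `p ≥ 5`); `(LT, P⁰, Q⁰)` the transported period maps (`exists_transported_periodHoms`) and
`(A, B, d)` a Hodge line `‖p^d·[Xⁿ](log_{W_D} − A·log_{E₀} − B·log_{E₀}(Xᵖ))‖ ≤ 1` with `(A, B) ≠ 0` (the Summits-side
`TransportedHodgeLine.exists_transportedHodgeLine`).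

* ★★★★ `exists_const_tatePairingPoint_eq_neg_trace_transported_formalPoint` — GIVEN ONLY the cell data (Weil tower, `ψ = log χ`, de Rham binders),
  the Hodge line and **`hne` in branch (a)** (`(∃ τ, θ(P⁰τ) ≠ 0) → ι(A)P⁰ + ι(B)Q⁰ ≢ 0` — the one classical input not in the tree, Brinon–Conrad
  Thm. 9.1.5 / `BmaxPlusTransportedHodgePairHne`), there is ONE `c ∈ F` such that for every `η ∈ Z¹(Γ_F, T_pE)`, every `P ∈ E(F)` with a
  `p`-power division sequence `Q` (`Q₀ = P`) whose base is a formal point of depth `‖z(P)‖^N ≤ ‖p‖` (`N ≥ e`), and every `c_P ∈ F` with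
  `ι(c_P) = p^N·Σ'[Xʲ]log_{W_D}·z(P)ʲ` (`= p^N·log_ω(P)`, chart `FormalLogValuesIntegralCoeffChart`):
  **`⟨[η], P⟩ = −Tr_{F/ℚ_p}(c_P · exp*_d(η) · c)`.**

Discharged inside (all tree theorems): the canonical matching `em = θ_∞ ≫ tateGeomEquivTatePtOSS` and its equivariance
(`TatePairingPointOfKTwoCanonical.em_canonical_smul`), the `T`-adic Kummer cocycle and its level classes (`LocalTatePairingKummerTadic`), its image
`κ_u` (`em_tadicKummer_eq_kummerCocycleO`), the CM-fibre transport `Tu` of the Kummer tower `u = z(Q)` (`exists_unique_int_divisionSeq_of_ramified`),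
the transported integrating pair `(f Λ_{Tu}, f φΛ_{Tu})` (`transported_integrating_pair`), `θ(ι(A)fΛ_{Tu} + ι(B)fφΛ_{Tu}) = p^N·log_{W_D}(z(P))`
(`AinfRamTop.thetaBdR_transportedHodgeCombination_eq`), `Pω″ = ι(A)P⁰ + ι(B)Q⁰ ⊆ Fil¹` (`…_eq_zero_of_torsion`), the branch
(`(b)`: `θ∘P⁰ ≡ 0` forces `B = 0`, `Pη″ := Q⁰`, `hnot`/`hne` by non-degeneracy `thetaBmaxPlus_frobBmaxPlus_logSum_transport_ne_zero` and
`transported_P₀_ne_zero`; `(a)`: `Pη″ := P⁰`, `hnot` free, `hne` = the hypothesis), and (K₂) on a `ℤ_p`-basis of `T_pE`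
(`isTeichLog_transported_resolution` with the Dieudonné–Honda relation `frobBmaxPlus_hondaTrace_logSum_divisionLiftPt_eq_zero` on `Tu`).

HONEST LIMITS: this is [REC] at the deep formal points of ONE ramified good supersingular model over `F = K_v`, modulo the Hodge line (Summits-side theorem)
and `hne` in branch (a); the K★ cells need in addition their instances (`E₀ = ⟨0,0,0,a,0⟩ / ⟨0,0,0,0,b⟩`, `p ∈ {5,7}`). BSD / K★
(`stmt-BirchSwinnertonDyer-22226`) / [REC-tower] are NOT proved by this file.

## References
* K. Kato, LNM 1553 (1993), Ch. II Thm. 1.4.1, Lemma 1.4.3. [Kato1993LNM1553]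
* S. Bloch, K. Kato (1990), Ex. 3.10.1, Example 3.11. [BlochKato1990]
* P. Colmez, Math. Ann. 292 (1992), §2. [Colmez1992PeriodesAbeliennes]
* N. M. Katz, *Crystalline cohomology, Dieudonné modules, and Jacobi sums* (1981), Thm. 5.1.4–5.1.5. [Katz1981CrystallineDieudonne]
* J. H. Silverman, *AEC* (2009), Prop. VII.2.1–VII.2.2, VIII §2. [SilvermanAEC2009]
-/

noncomputable section

open Field Function ValuativeRel WittVector NumberField IsDedekindDomain
open scoped NumberField Topology

namespace Literature.NumberTheory.PAdicHodge

open Literature.NumberTheory.GaloisRepresentations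
open Literature.NumberTheory.GaloisRepresentations.IsNonarchimedeanLocalField
open Literature.NumberTheory.GaloisRepresentations.LubinTate
open Literature.NumberTheory.GaloisCohomology
open Literature.NumberTheory.EllipticCurves
open Literature.NumberTheory.EllipticCurves.FormalGroupChart
open Literature.NumberTheory.PAdicHodge.GaloisContinuity
open Literature.IUT.LogVolume
open Literature.RingTheory.FormalGroups Literature.AlgebraicGeometry.Resolution
open _root_.WeierstrassCurve

section Completion

variable {K : Type} [Field K] [NumberField K] {p : ℕ} [hprime : Fact p.Prime] (v : HeightOneSpectrum (𝓞 K))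
  [CharZero (v.adicCompletion K)] [LocallyCompactSpace (absoluteGaloisGroup (v.adicCompletion K))]
  [Fact (¬ IsUnit (p : integerC (v.adicCompletion K)))]
  [IsAdicComplete (Ideal.span {(p : integerC (v.adicCompletion K))}) (integerC (v.adicCompletion K))]
  [CharP 𝓀[v.adicCompletion K] p] [CharZero (CompletedAlgClosure (v.adicCompletion K))]
  (hpv : valuation (v.adicCompletion K) (p : v.adicCompletion K) < 1)
  (Dv : EisensteinRoot (v.adicCompletion K) p hpv) (Wm : WeierstrassCurve (EisensteinRoot.CoeffDisc Dv))
  (ψm : EisensteinRoot.CoeffDisc Dv →+* LTCoeff (v.adicCompletion K))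
  (hψm : ∀ c, algebraMap (LTCoeff (v.adicCompletion K)) (v.adicCompletion K) (ψm c) = EisensteinRoot.CoeffDisc.toF Dv c)
  (hp2 : p ≠ 2) (hΔ : IsUnit (Wm.map ψm).Δ) (hA : ((Wm.map ψm).map (AinfTop.redCoeff (v.adicCompletion K))).hasseCoeff p = 0)
  [(AinfTop.curveFO (v.adicCompletion K) (Wm.map ψm)).IsElliptic]
  [(curveOver (CompletedAlgClosure (v.adicCompletion K)) (Wm.map ψm)).IsElliptic]
  (e : (k : ℕ) → geomTorsion (AinfTop.curveFO (v.adicCompletion K) (Wm.map ψm)) ((p ^ k : ℕ) : ℤ) →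
    geomTorsion (AinfTop.curveFO (v.adicCompletion K) (Wm.map ψm)) ((p ^ k : ℕ) : ℤ) → AlgebraicClosure (v.adicCompletion K))
  (hμ : ∀ k S T, e k S T ^ (p ^ k) = 1) (hadd₁ : ∀ k S₁ S₂ T, e k (S₁ + S₂) T = e k S₁ T * e k S₂ T)
  (hadd₂ : ∀ k S T₁ T₂, e k S (T₁ + T₂) = e k S T₁ * e k S T₂)
  (hgal : ∀ k (σ : absoluteGaloisGroup (v.adicCompletion K))
    (S T : geomTorsion (AinfTop.curveFO (v.adicCompletion K) (Wm.map ψm)) ((p ^ k : ℕ) : ℤ)), σ • e k S T = e k (σ • S) (σ • T))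
  (hcompat : ∀ k (S T : geomTorsion (AinfTop.curveFO (v.adicCompletion K) (Wm.map ψm)) ((p ^ (k + 1) : ℕ) : ℤ)),
    e k (torsionMulHom (AinfTop.curveFO (v.adicCompletion K) (Wm.map ψm)) (p ^ (k + 1)) (p ^ k) p (pow_succ p k).symm S)
      (torsionMulHom (AinfTop.curveFO (v.adicCompletion K) (Wm.map ψm)) (p ^ (k + 1)) (p ^ k) p (pow_succ p k).symm T) =
        e (k + 1) S T ^ p)

set_option maxHeartbeats 4800000 in
include hgal hp2 hΔ hA hψm in
/-- ★★★★ **Kato's explicit reciprocity law at `F = K_v` for a RAMIFIED good supersingular model `W_D ≡ E₀ (mod ϖ)`, at EVERY cocycle and EVERY deep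
formal point — no (K₂), no matching, no cocycle, no integrating-pair, no `Fil¹`/non-degeneracy hypothesis.** Inputs: the cell data (Weil tower `e` with
`heL/healt/henondeg`, `ψ = log χ`, the de Rham binders `hinj / hde / d`), the good supersingular `ℤ`-curve `E₀` (`p ≥ 5`, `p ∤ Δ(E₀)`, Hasse `0`) with
`W_D ≡ E₀ (mod ϖ)`, the transported period maps `(LT, P⁰, Q⁰)` at an index `N ≥ e` with their specification (from `exists_transported_periodHoms`),
a Hodge line `(A, B, d)` with `(A, B) ≠ 0`, and `hne` in branch (a): `(∃ τ, θ(P⁰τ) ≠ 0) → ∃ τ, ι(A)P⁰τ + ι(B)Q⁰τ ≠ 0`. Then there is ONE `c ∈ F`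
such that for every `η ∈ Z¹(Γ_F, T_pE)`, every `P ∈ E(F)` with a `p`-power division sequence `Q` (`Q₀ = P`) whose base is a formal point with
`‖z(P)‖^N ≤ ‖p‖`, and every `c_P ∈ F` with `ι(c_P) = p^N·Σ'[Xʲ]log_{W_D}·z(P)ʲ`:

  **`⟨[η], P⟩ = −Tr_{F/ℚ_p}(c_P · exp*_d(η) · c)`.**

[cite: Kato1993LNM1553, Ch. II Thm. 1.4.1 (3)–(4) and Lemma 1.4.3] [cite: BlochKato1990, Ex. 3.10.1, Example 3.11]
[cite: Colmez1992PeriodesAbeliennes, §2] [cite: Katz1981CrystallineDieudonne, Thm. 5.1.4–5.1.5] [cite: SilvermanAEC2009, Prop. VII.2.2 and VIII §2] -/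
theorem exists_const_tatePairingPoint_eq_neg_trace_transported_formalPoint (hp5 : 5 ≤ p)
    (E₀ : WeierstrassCurve ℤ)
    (hWE : Wm.map (Ideal.Quotient.mk (Ideal.span {EisensteinRoot.CoeffDisc.of Dv (AdjoinRoot.root Dv.poly)})) =
      (E₀.map (algebraMap ℤ (EisensteinRoot.CoeffDisc Dv))).map
        (Ideal.Quotient.mk (Ideal.span {EisensteinRoot.CoeffDisc.of Dv (AdjoinRoot.root Dv.poly)})))
    (hΔ₀ : ¬ (p : ℤ) ∣ E₀.Δ) (hA₀ : (E₀.map (Int.castRingHom (ZMod p))).hasseCoeff p = 0)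
    [(E₀.map (Int.castRingHom ℚ_[p])).IsElliptic] [(E₀.map (Int.castRingHom (ZMod p))).IsElliptic]
    [(curveOver (CompletedAlgClosure (v.adicCompletion K)) E₀).IsElliptic]
    {N : ℕ} (hN : Dv.e ≤ N) {LT : AinfTop.TatePtO (v.adicCompletion K) (Wm.map ψm) p →+ BmaxPlus (v.adicCompletion K) p}
    {P₀ Q₀ : AinfTop.TatePtO (v.adicCompletion K) (Wm.map ψm) p →+ BdRPlusTop (v.adicCompletion K) p}
    (hLT : ∀ (τ : AinfTop.TatePtO (v.adicCompletion K) (Wm.map ψm) p) (w : ℕ → (maxNilIdealC (v.adicCompletion K)).toIdeal)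
        (hw : ∀ n, AinfTop.mulPC (v.adicCompletion K) p E₀ (w (n + 1)) = w n)
        (_ : ∀ n, ‖(((w n : (maxNilIdealC (v.adicCompletion K)).toIdeal) : CBall (v.adicCompletion K)) : CompletedAlgClosure (v.adicCompletion K)) -
          (((AinfTop.seqO (Wm.map ψm) τ n : (maxNilIdealC (v.adicCompletion K)).toIdeal) : CBall (v.adicCompletion K)) :
            CompletedAlgClosure (v.adicCompletion K))‖ ≤
          ‖((Dv.rootC : integerC (v.adicCompletion K)) : CompletedAlgClosure (v.adicCompletion K))‖)
        (z : bmaxZero (v.adicCompletion K) p), algebraMap (Ainf (p := p) (v.adicCompletion K)) (bmaxZero (v.adicCompletion K) p)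
          ((AinfTop.of (v.adicCompletion K) p).symm (((AinfTop.divisionLiftPt E₀ (surjective_fontaineTheta_integerC hpv) w hw).val :
            (AinfTop.nilTheta (v.adicCompletion K) p (surjective_fontaineTheta_integerC hpv)).toIdeal) : AinfTop (v.adicCompletion K) p)) ^ N =
          (p : bmaxZero (v.adicCompletion K) p) * z →
        LT τ = PadicLogSeries.logSum ((algebraMap (Ainf (p := p) (v.adicCompletion K)) (bmaxZero (v.adicCompletion K) p)).comp zpToAinf)
          (GaloisContinuity.formalLogNum E₀ p) N
          (algebraMap (Ainf (p := p) (v.adicCompletion K)) (bmaxZero (v.adicCompletion K) p)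
            ((AinfTop.of (v.adicCompletion K) p).symm (((AinfTop.divisionLiftPt E₀ (surjective_fontaineTheta_integerC hpv) w hw).val :
              (AinfTop.nilTheta (v.adicCompletion K) p (surjective_fontaineTheta_integerC hpv)).toIdeal) : AinfTop (v.adicCompletion K) p))) z)
    (hP₀ : ∀ τ, P₀ τ = BdRPlusTop.of (v.adicCompletion K) p (bmaxPlusToBdR (v.adicCompletion K) p (LT τ)))
    (hQ₀ : ∀ τ, Q₀ τ = BdRPlusTop.of (v.adicCompletion K) p (bmaxPlusToBdR (v.adicCompletion K) p (frobBmaxPlus (v.adicCompletion K) p (LT τ))))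
    (hP₀Z : ∀ (c : ℤ_[p]) (τ : AinfTop.TatePtO (v.adicCompletion K) (Wm.map ψm) p),
      P₀ (c • τ) = BdRPlusTop.of (v.adicCompletion K) p (qpToBdR (c : ℚ_[p])) * P₀ τ)
    (hQ₀Z : ∀ (c : ℤ_[p]) (τ : AinfTop.TatePtO (v.adicCompletion K) (Wm.map ψm) p),
      Q₀ (c • τ) = BdRPlusTop.of (v.adicCompletion K) p (qpToBdR (c : ℚ_[p])) * Q₀ τ)
    (hP₀g : ∀ (σ : absoluteGaloisGroup (v.adicCompletion K)) (τ : AinfTop.TatePtO (v.adicCompletion K) (Wm.map ψm) p),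
      BdRPlusTop.gal (v.adicCompletion K) p σ (P₀ τ) = P₀ (σ • τ))
    (hQ₀g : ∀ (σ : absoluteGaloisGroup (v.adicCompletion K)) (τ : AinfTop.TatePtO (v.adicCompletion K) (Wm.map ψm) p),
      BdRPlusTop.gal (v.adicCompletion K) p σ (Q₀ τ) = Q₀ (σ • τ))
    (A B : v.adicCompletion K) (dHL : ℕ)
    (hHL : ∀ n : ℕ, ‖(p : CompletedAlgClosure (v.adicCompletion K)) ^ dHL * PowerSeries.coeff n
        ((Wm.map ((CBall (v.adicCompletion K)).subtype.comp (EisensteinRoot.CoeffDisc.toCBall Dv))).formalLog -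
          PowerSeries.C (algebraMap (v.adicCompletion K) (CompletedAlgClosure (v.adicCompletion K)) A) *
            (E₀.map (Int.castRingHom (CompletedAlgClosure (v.adicCompletion K)))).formalLog -
          PowerSeries.C (algebraMap (v.adicCompletion K) (CompletedAlgClosure (v.adicCompletion K)) B) *
            PowerSeries.expand p hprime.out.ne_zero (E₀.map (Int.castRingHom (CompletedAlgClosure (v.adicCompletion K)))).formalLog)‖ ≤ 1)
    (hAB : A ≠ 0 ∨ B ≠ 0)
    (hne_a : (∃ τ, thetaBdR ((BdRPlusTop.of (v.adicCompletion K) p).symm (P₀ τ)) ≠ 0) →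
      ∃ τ, BdRPlusTop.of (v.adicCompletion K) p (embBdRHom hpv (surjective_fontaineTheta_integerC hpv) A) * P₀ τ +
        BdRPlusTop.of (v.adicCompletion K) p (embBdRHom hpv (surjective_fontaineTheta_integerC hpv) B) * Q₀ τ ≠ 0)
    (ψ : C(absoluteGaloisGroup (v.adicCompletion K), ℤ_[p])) (hψ : ∀ σ τ, ψ (σ * τ) = ψ σ + ψ τ)
    (hψlog : ∀ τ, (ψ τ : ℚ_[p]) = logCyclotomic (F := (v.adicCompletion K)) p τ)
    (heL : ∀ (c : ℤ_[p]) (S U : (AinfTop.curveFO (v.adicCompletion K) (Wm.map ψm)).tateModule p),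
      (weilContPairingPadic (AinfTop.curveFO (v.adicCompletion K) (Wm.map ψm)) (v.adicCompletion K) p e hμ hadd₁ hadd₂ hgal hcompat).toLin (c • S) U =
      twistHom (v.adicCompletion K) p ((weilContPairingPadic (AinfTop.curveFO (v.adicCompletion K) (Wm.map ψm)) (v.adicCompletion K) p e hμ hadd₁ hadd₂ hgal hcompat).toLin S U) c)
    (healt : ∀ S : (AinfTop.curveFO (v.adicCompletion K) (Wm.map ψm)).tateModule p,
      (weilContPairingPadic (AinfTop.curveFO (v.adicCompletion K) (Wm.map ψm)) (v.adicCompletion K) p e hμ hadd₁ hadd₂ hgal hcompat).toLin S S = 0)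
    (henondeg : ∀ S : (AinfTop.curveFO (v.adicCompletion K) (Wm.map ψm)).tateModule p,
      (∀ U, (weilContPairingPadic (AinfTop.curveFO (v.adicCompletion K) (Wm.map ψm)) (v.adicCompletion K) p e hμ hadd₁ hadd₂ hgal hcompat).toLin S U = 0) → S = 0)
    (hinj : letI := LocalField.padicAlgebra (v.adicCompletion K) p hpv
      (bdRPeriodRingData (F := (v.adicCompletion K)) (p := p) hpv).CupLogInjective (logCyclotomic p)
        (restrictedRationalTateRep (AinfTop.curveFO (v.adicCompletion K) (Wm.map ψm)) (v.adicCompletion K) p))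
    (hde : letI := LocalField.padicAlgebra (v.adicCompletion K) p hpv
      ∀ η : contOneCocycles (restrictedTateRep (AinfTop.curveFO (v.adicCompletion K) (Wm.map ψm)) (v.adicCompletion K) p).toTopRep,
        (bdRPeriodRingData (F := (v.adicCompletion K)) (p := p) hpv).HasDualExp (logCyclotomic p)
          (restrictedRationalTateRep (AinfTop.curveFO (v.adicCompletion K) (Wm.map ψm)) (v.adicCompletion K) p)
          fun σ => TateModule.toRational p (η.1 σ))
    (d : letI := LocalField.padicAlgebra (v.adicCompletion K) p hpv
      (bdRPeriodRingData (F := (v.adicCompletion K)) (p := p) hpv).FilZeroLine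
        (restrictedRationalTateRep (AinfTop.curveFO (v.adicCompletion K) (Wm.map ψm)) (v.adicCompletion K) p)) :
    letI := LocalField.padicAlgebra (v.adicCompletion K) p hpv
    ∃ c : v.adicCompletion K,
      ∀ (η : contOneCocycles (restrictedTateRep (AinfTop.curveFO (v.adicCompletion K) (Wm.map ψm)) (v.adicCompletion K) p).toTopRep)
        (P : ((AinfTop.curveFO (v.adicCompletion K) (Wm.map ψm)).baseChange (v.adicCompletion K)).toAffine.Point)
        (Q : ℕ → geomPoints ((AinfTop.curveFO (v.adicCompletion K) (Wm.map ψm)).baseChange (v.adicCompletion K)))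
        (hQ : ∀ n, p • Q (n + 1) = Q n)
        (_hQ0 : Q 0 = toGeomPoints ((AinfTop.curveFO (v.adicCompletion K) (Wm.map ψm)).baseChange (v.adicCompletion K)) P)
        (hP1 : AinfTop.geomToCO (Wm.map ψm) (Q 0) ∈ kernel (NormedField.valuation (K := CompletedAlgClosure (v.adicCompletion K)))
          (curveOver (CompletedAlgClosure (v.adicCompletion K)) (Wm.map ψm))),
        ‖((zPt (AinfTop.geomToCO (Wm.map ψm) (Q 0)) hP1 : CBall (v.adicCompletion K)) : CompletedAlgClosure (v.adicCompletion K))‖ ^ N ≤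
            ‖(p : CompletedAlgClosure (v.adicCompletion K))‖ →
        ∀ cP : v.adicCompletion K,
          algebraMap (v.adicCompletion K) (CompletedAlgClosure (v.adicCompletion K)) cP =
            (p : CompletedAlgClosure (v.adicCompletion K)) ^ N *
              ∑' j : ℕ, PowerSeries.coeff j (Wm.map ((CBall (v.adicCompletion K)).subtype.comp (EisensteinRoot.CoeffDisc.toCBall Dv))).formalLog *
                ((zPt (AinfTop.geomToCO (Wm.map ψm) (Q 0)) hP1 : CBall (v.adicCompletion K)) : CompletedAlgClosure (v.adicCompletion K)) ^ j →
          ((tatePairingPoint (AinfTop.curveFO (v.adicCompletion K) (Wm.map ψm)) (v.adicCompletion K) p e hμ hadd₁ hadd₂ hgal hcompat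
              (oneCocycleClass _ η) P : ℤ_[p]) : ℚ_[p]) =
            -Algebra.trace ℚ_[p] (v.adicCompletion K) (cP * (expStarCoord (AinfTop.curveFO (v.adicCompletion K) (Wm.map ψm)) hpv d η * c)) := by
  have hprime' : p.Prime := Fact.out
  haveI := module_free_tateModule_holds (AinfTop.curveFO (v.adicCompletion K) (Wm.map ψm)) p
  haveI := module_finite_tateModule_holds (AinfTop.curveFO (v.adicCompletion K) (Wm.map ψm)) p
  -- a nonzero element of `T_pŴ_D` (rank two of `T_pE` and the canonical matching)
  have hex : ∃ τ₀ : AinfTop.TatePtO (v.adicCompletion K) (Wm.map ψm) p, τ₀ ≠ 0 := by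
    let b2 := Module.finBasisOfFinrankEq ℤ_[p] ((AinfTop.curveFO (v.adicCompletion K) (Wm.map ψm)).tateModule p)
      (finrank_tateModule_eq_two_holds (AinfTop.curveFO (v.adicCompletion K) (Wm.map ψm)) p (Nat.cast_ne_zero.2 hprime'.ne_zero))
    exact ⟨((tateModuleEquiv (AinfTop.curveFO (v.adicCompletion K) (Wm.map ψm)) (v.adicCompletion K) p).trans
        (AinfTop.tateGeomEquivTatePtOSS (v.adicCompletion K) (Wm.map ψm) p hp2 hΔ hA)) (b2 0),
      fun h => b2.ne_zero 0 (((tateModuleEquiv (AinfTop.curveFO (v.adicCompletion K) (Wm.map ψm)) (v.adicCompletion K) p).trans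
        (AinfTop.tateGeomEquivTatePtOSS (v.adicCompletion K) (Wm.map ψm) p hp2 hΔ hA)).map_eq_zero_iff.1 h)⟩
  -- THE BRANCH: the recombined pair `Pω″ = ι(A)P⁰ + ι(B)Q⁰ ⊆ Fil¹`, `Pη″ = ι(C)P⁰ + ι(C′)Q⁰`, with `hne`, `hnot`
  obtain ⟨C, C', Pω₀, Pη₀, hPω₀, hPη₀, hfil₀, hne₀, hnot₀⟩ := exists_transported_etaPartner hpv Dv Wm E₀ hWE ψm hψm hN hLT hP₀ hQ₀ A B dHL
    hHL hp5 hΔ₀ hA₀ hAB hex hne_a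
  -- FILE A: the capstone with the recombined transported pair along the canonical matching (partial application, then the line `d`)
  have hpart := exists_const_tatePairingPoint_eq_neg_trace_of_KTwo_transported_of_matching v
    (AinfTop.curveFO (v.adicCompletion K) (Wm.map ψm)) e hμ hadd₁ hadd₂ hgal hcompat hpv Dv Wm E₀ hWE ψm hψm
    ((tateModuleEquiv (AinfTop.curveFO (v.adicCompletion K) (Wm.map ψm)) (v.adicCompletion K) p).trans
      (AinfTop.tateGeomEquivTatePtOSS (v.adicCompletion K) (Wm.map ψm) p hp2 hΔ hA))
    (em_canonical_smul v hpv Dv Wm ψm hp2 hΔ hA) hN hLT hP₀ hQ₀ hP₀Z hQ₀Z hP₀g hQ₀g A B C C' hAB hPω₀ hPη₀ hfil₀ hne₀ hnot₀ ψ hψ hψlog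
    heL healt henondeg hinj hde
  obtain ⟨cL, c, -, -, hmain⟩ := hpart d
  clear hpart
  -- the per-point Kummer data along the canonical matching, with (K₂) PROVED
  -- (STEPWISE application: a one-shot application of this many-binder theorem costs a prohibitive amount of elaboration)
  have hB3 := exists_transported_kummer_data v hpv Dv Wm ψm hψm hp2 hΔ hA E₀ hWE (N := N) hN (LT := LT) (P₀ := P₀) (Q₀ := Q₀)
  have hB3' := hB3 hLT
  have hB3'' := hB3' hP₀ hQ₀ A B dHL
  have hdata := hB3'' hHL
  clear hB3 hB3' hB3''
  refine ⟨c, fun η P Q hQ hQ0 hP1 huN cP hcP => ?_⟩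
  have hdataP := hdata P Q hQ hQ0 hP1
  have hdataP' := hdataP huN cP hcP
  obtain ⟨κ, bω₀, bη₀, h1, h2, h3, h4, hK⟩ := hdataP'
  exact hmain η κ P h1 bω₀ bη₀ cP h2 h3 h4 (Module.Free.chooseBasis ℤ_[p] _) fun i => hK _

end Completion

end Literature.NumberTheory.PAdicHodge

end
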